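import Mathlib.GroupTheory.SpecificGroups.Dihedral
import Literature.Combinatorics.Additive.TripleProductProperty
import HarnessLib

/-!
# A `law − 4` triple of shape P3 in the dihedral group `D₃₂`: the dicyclic hypothesis in `DicyclicNoSubFourP5` /
# `DicyclicSubFourP3Structure` is essential

ω-census, family (b3).  Framing: lottery ticket; floor = certified bounds/negative ranges.

`D₃₂ = DihedralGroup 16` is the dihedral-like group `G(ℤ₁₆, 0)` (`ρ a = r a`, `τ a = sr a`), `|A| = 16 ≡ 1 (mod 3)`, mod-one
law `(8·16 − 8)/3 = 40` (attained, `dihedral_law`).  The triple below has coset parts `(2,1 | 1,1 | 3,3)` — shape P3 with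
`c = 1` (`16 = 9·1 + 7`) — and volume `3·2·6 = 36 = law − 4`.  So P3 `law − 4` triples DO occur in dihedral type
(seat census: `D₃₂` has 14 976 of them, `C₂ × D₁₆` 11 520), while every dicyclic-type group of order `32`
(`Q₃₂`, `ℤ₈ ⋊ ℤ₄`, `C₂ × Q₁₆`) has none (exhaustive, seat pub-omega-group-g9) — consistent with the conjecture that
dicyclic type is P3-free, of which `DicyclicSubFourP3Structure.lean` proves the first structural step.
One explicit triple checked by `decide`; nothing on `ω`.
-/

namespace Summit.MatrixMultiplication.OmegaCensus.DihedralSubFourP3Example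

open Literature.Combinatorics.Additive

/-- **A P3-shaped TPP triple of volume `36 = law − 4` in `D₃₂`**: `S = {r0, r5, sr4}`, `T = {r0, sr0}`,
`U = {r0, r7, r9, sr1, sr3, sr10}` (kernel `decide`). [folklore] -/
theorem tpp : TripleProductProperty
    ({DihedralGroup.r (0 : ZMod 16), DihedralGroup.r 5, DihedralGroup.sr 4} : Finset (DihedralGroup 16))
    ({DihedralGroup.r (0 : ZMod 16), DihedralGroup.sr 0} : Finset (DihedralGroup 16))
    ({DihedralGroup.r (0 : ZMod 16), DihedralGroup.r 7, DihedralGroup.r 9, DihedralGroup.sr 1, DihedralGroup.sr 3,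
      DihedralGroup.sr 10} : Finset (DihedralGroup 16)) := by
  unfold TripleProductProperty; decide +kernel

/-- Its volume is `3 · 2 · 6 = 36`, i.e. `3 · 36 + 20 = 8 · 16`: exactly `law − 4` for `|A| = 16`. [folklore] -/
theorem volume :
    ({DihedralGroup.r (0 : ZMod 16), DihedralGroup.r 5, DihedralGroup.sr 4} : Finset (DihedralGroup 16)).card *
      ({DihedralGroup.r (0 : ZMod 16), DihedralGroup.sr 0} : Finset (DihedralGroup 16)).card *
      ({DihedralGroup.r (0 : ZMod 16), DihedralGroup.r 7, DihedralGroup.r 9, DihedralGroup.sr 1, DihedralGroup.sr 3,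
        DihedralGroup.sr 10} : Finset (DihedralGroup 16)).card = 36 ∧ 3 * 36 + 20 = 8 * 16 := by
  refine ⟨?_, by norm_num⟩
  decide +kernel


/-- **A P5-shaped TPP triple of volume `100 = law − 4` in `D₈₀`** (`|A| = 40`, law `104`; parts `(3,2 | 1,1 | 5,5)`):
`S = {r0, r19, r38, sr2, sr23}`, `T = {r0, sr22}`, `U = r(8ℤ₄₀) ∪ sr(5 + 8ℤ₄₀)` (kernel `decide`; found by kissat, seat
census kit j141306).  So the P5 shape, impossible in every dicyclic-type group (`no_sub_four_P5_of_c0_ne_zero`), does occur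
in dihedral type. [folklore] -/
theorem tpp_P5_D80 : TripleProductProperty
    ({DihedralGroup.r (0 : ZMod 40), DihedralGroup.r 19, DihedralGroup.r 38, DihedralGroup.sr 2, DihedralGroup.sr 23} :
      Finset (DihedralGroup 40))
    ({DihedralGroup.r (0 : ZMod 40), DihedralGroup.sr 22} : Finset (DihedralGroup 40))
    ({DihedralGroup.r (0 : ZMod 40), DihedralGroup.r 8, DihedralGroup.r 16, DihedralGroup.r 24, DihedralGroup.r 32,
      DihedralGroup.sr 5, DihedralGroup.sr 13, DihedralGroup.sr 21, DihedralGroup.sr 29, DihedralGroup.sr 37} :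
      Finset (DihedralGroup 40)) := by
  unfold TripleProductProperty; decide +kernel

/-- Its volume: `5 · 2 · 10 = 100` and `3 · 100 + 20 = 8 · 40` (`law − 4`). [folklore] -/
theorem volume_P5_D80 :
    ({DihedralGroup.r (0 : ZMod 40), DihedralGroup.r 19, DihedralGroup.r 38, DihedralGroup.sr 2, DihedralGroup.sr 23} :
        Finset (DihedralGroup 40)).card *
      ({DihedralGroup.r (0 : ZMod 40), DihedralGroup.sr 22} : Finset (DihedralGroup 40)).card *
      ({DihedralGroup.r (0 : ZMod 40), DihedralGroup.r 8, DihedralGroup.r 16, DihedralGroup.r 24, DihedralGroup.r 32,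
        DihedralGroup.sr 5, DihedralGroup.sr 13, DihedralGroup.sr 21, DihedralGroup.sr 29, DihedralGroup.sr 37} :
        Finset (DihedralGroup 40)).card = 100 ∧ 3 * 100 + 20 = 8 * 40 := by
  refine ⟨?_, by norm_num⟩
  decide +kernel

end Summit.MatrixMultiplication.OmegaCensus.DihedralSubFourP3Example
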